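import Mathlib

/-!
# Error of a tensor-product quadrature rule evaluated through a tensor approximation

L. I. Vysotsky, A. V. Smirnov and E. E. Tyrtyshnikov, *Tensor-Train Numerical Integration of
Multivariate Functions with Singularities*, Lobachevskii J. Math. **42** (2021) 1608–1621
(`VysotskySmirnovTyrtyshnikov2021`, arXiv:2103.12129), approximate `I(f) = ∫₀¹⋯∫₀¹ f dx_1⋯dx_d` by
a tensor-product quadrature rule with nodes `x_k^{(i_k)}` and weights `w_k^{(i_k)}` on axis `k`,
`S_{X,W}(f) = Σ_{i_1,…,i_d} f(x_1^{(i_1)},…,x_d^{(i_d)}) W(i_1,…,i_d)`,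
`W(i_1,…,i_d) = w_1^{(i_1)} ⋯ w_d^{(i_d)}` [VST21, §2], i.e. `S_{X,W}(f) = ⟨Ā_{X,f}, W⟩` where
`A_{X,f}(i_1,…,i_d) = f(x_1^{(i_1)},…,x_d^{(i_d)})` is the tensor of function values on the grid, and
then replace `A_{X,f}` (which has `n_1⋯n_d` entries) by a tensor-train approximation `A'` obtained by
TT-cross interpolation, computing `S' = ⟨Ā', W⟩` instead.  Their error analysis [VST21, §3.6] reads:

* **Lemma 1.**  Put `I_0 = f`, `I_k(x_{k+1},…,x_d) = ∫₀¹⋯∫₀¹ f(x_1,…,x_d) dx_1⋯dx_k`, `I_d = I(f)`.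
  Assume that for all `k = 1,…,d` (good quadrature) the rule on axis `k` has nonnegative weights and
  is exact for constants, `w_k^{(i_k)} ≥ 0`, `1 = ∫₀¹ 1 dx = Σ_{i_k} w_k^{(i_k)}`, and
  (partial integral) for all `x_{k+1},…,x_d ∈ [0,1]`,
  `|∫₀¹ I_{k-1}(x_k,x_{k+1},…,x_d) dx_k - Σ_{i_k} I_{k-1}(x_k^{(i_k)},x_{k+1},…,x_d) w_k^{(i_k)}| ≤ ε_int`.
  Then `|I(f) - S_{X,W}(f)| ≤ d·ε_int`.  The proof is the induction (integration-induction)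
  `|I_k(x_{k+1},…,x_d) - Σ_{i_1,…,i_k} f(x_1^{(i_1)},…,x_k^{(i_k)},x_{k+1},…,x_d) w_1^{(i_1)}⋯w_k^{(i_k)}|
  ≤ k·ε_int`: add and subtract `Σ_{i_k} I_{k-1}(x_k^{(i_k)},x_{k+1},…) w_k^{(i_k)}`, use the triangle
  inequality, (partial integral), `w ≥ 0`, the induction hypothesis and `Σ_{i_k} w_k^{(i_k)} = 1`.
* **Theorem 1.**  If moreover `‖A_{X,f} - A'‖_F ≤ ε_appr`, then
  `|I(f) - ⟨Ā', W⟩| ≤ d·ε_int + ε_appr`: triangle inequality, the Cauchy–Bunyakovsky–Schwarz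
  inequality `|⟨A_{X,f} - A', W⟩| ≤ ‖A_{X,f} - A'‖_F ‖W‖_F`, and `‖W‖_F ≤ 1` because
  `0 ≤ w_k^{(i_k)} ≤ 1` gives `‖W‖_F² = Σ ∏ (w_k^{(i_k)})² ≤ Σ ∏ w_k^{(i_k)} = ∏_k Σ_{i_k} w_k^{(i_k)} = 1`.

This file formalises exactly these statements, for `f` with values in an arbitrary real normed
space `E` (the paper: `E = ℂ`):

* `TensorRule.setCoord`, `TensorRule.iterOp` — the substitution `x_k := t` and the axis-by-axis
  elimination `I_k = op_k I_{k-1}(·, x_{k+1}, …)` common to `I_k` and to the partial sums;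
  `TensorRule.partialIntegral f k` = `I_k`, `TensorRule.iteratedIntegral f` = `I_d = I(f)`;
  `TensorRule.partialRule x w f k` = `Σ_{i_1,…,i_k} f(x_1^{(i_1)},…,x_k^{(i_k)},·) w_1^{(i_1)}⋯w_k^{(i_k)}`;
* `TensorRule.weightTensor w` = `W`, `TensorRule.node x i` = the grid point `(x_1^{(i_1)},…,x_d^{(i_d)})`,
  `TensorRule.tensorRule x w f` = `S_{X,W}(f) = ⟨Ā_{X,f}, W⟩` [VST21, §2];
  `TensorRule.partialRule_eq_tensorRule` — the `k = d` partial sum is `S_{X,W}(f)`;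
* `TensorRule.norm_iterOp_sub_partialRule_le` — the induction (integration-induction), stated for an
  arbitrary functional `op k` in place of `∫₀¹ · dx_k` and an arbitrary set `S` of admissible
  coordinates in place of `[0,1]` (the proof in [VST21] uses nothing about the integral);
  `TensorRule.norm_iteratedIntegral_sub_tensorRule_le` — **Lemma 1** verbatim;
* `TensorRule.sum_weightTensor_eq_one`, `TensorRule.weightTensor_nonneg`,
  `TensorRule.weightTensor_le_one`, `TensorRule.sum_weightTensor_sq_le_one` (`‖W‖_F ≤ 1`),
  `TensorRule.norm_sum_weightTensor_smul_sub_le` (`|⟨A_{X,f} - A', W⟩| ≤ ‖A_{X,f} - A'‖_F`) and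
  `TensorRule.norm_iteratedIntegral_sub_sum_weightTensor_smul_le` — **Theorem 1** verbatim, with the
  Frobenius norm written out as `√(Σ_i ‖A_{X,f}(i) - A'(i)‖²)`.

Dictionary and design choices.  Axes are numbered `0,…,d-1` (the paper: `1,…,d`), so
`partialIntegral f k` has the axes `0,…,k-1` integrated out and is the paper's `I_k`; it is kept as a
function on the whole cube, constant in the integrated coordinates (`TensorRule.iterOp_congr`), which
avoids dependent arities.  The nodes of axis `k` are indexed by an arbitrary finite type `ι k` (the
paper: `i_k = 0,…,n_k-1`).  No measurability or integrability hypothesis appears: Lemma 1 is a purely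
algebraic consequence of (good quadrature) and (partial integral), whatever the values of the
one-dimensional integrals `∫₀¹ · dx_k` are (`TensorRule.norm_iterOp_sub_partialRule_le` makes this
explicit), and Theorem 1 adds only the Cauchy–Bunyakovsky–Schwarz inequality.  `I(f)` is *defined* as the iterated integral `I_d`, exactly as `I_k` is
introduced in [VST21, §3.6]; its identification with the Lebesgue integral over `[0,1]^d` (Fubini) is
not part of the error analysis and is not repeated here.  The nodes are assumed to lie in `[0,1]`
(implicit in [VST21]: the induction hypothesis is applied at them).

Not formalised here: the two examples following Lemma 1 (exactness of the `s`-point Gauss rule on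
polynomials of coordinate degree `≤ 2s-1`, and the bound `(s!)⁴/((2s+1)((2s)!)³)·D·d` under a bound
`D` on `∂^{2s} f/∂x_k^{2s}`), the TT-cross approximation that produces `A'` [VST21, §§3.1–3.4], and
the treatment of singularities by changes of variables [VST21, §3.5].

Reference: L. I. Vysotsky, A. V. Smirnov, E. E. Tyrtyshnikov, *Tensor-Train Numerical Integration
of Multivariate Functions with Singularities*, Lobachevskii J. Math. 42:7 (2021) 1608–1621,
doi:10.1134/s1995080221070258 (`VysotskySmirnovTyrtyshnikov2021`).

AI-produced formalisation (H21 engines group, seat eng-quad-2, 2026-08-21); no facts, no axioms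
beyond Mathlib's, no `sorry`.
-/

open MeasureTheory

noncomputable section

namespace Literature.Analysis.Quadrature

namespace TensorRule

variable {X : Type*} {E : Type*}

/-! ### Axis-by-axis elimination -/

section Elimination

variable {d : ℕ}

/-- `setCoord y k t` is the point `y ∈ X^d` with its coordinate number `k` replaced by `t` — the
substitution `x_k := t` in `I_{k-1}(x_k, x_{k+1}, …, x_d)` of [VST21, §3.6].  Here `k` is a natural
number (axes are numbered `0, …, d-1`); for `k ≥ d` nothing is replaced.
[cite: VysotskySmirnovTyrtyshnikov2021, §3.6] -/
def setCoord (y : Fin d → X) (k : ℕ) (t : X) : Fin d → X :=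
  fun j => if (j : ℕ) = k then t else y j

/-- [folklore] -/
private theorem setCoord_of_eq {y : Fin d → X} {k : ℕ} {t : X} {j : Fin d} (h : (j : ℕ) = k) :
    setCoord y k t j = t := if_pos h

/-- [folklore] -/
private theorem setCoord_of_ne {y : Fin d → X} {k : ℕ} {t : X} {j : Fin d} (h : (j : ℕ) ≠ k) :
    setCoord y k t j = y j := if_neg h

/-- [folklore] -/
private theorem setCoord_mem {S : Set X} {y : Fin d → X} (hy : ∀ j, y j ∈ S) (k : ℕ) {t : X}
    (ht : t ∈ S) (j : Fin d) : setCoord y k t j ∈ S := by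
  unfold setCoord
  split_ifs
  exacts [ht, hy j]

/-- Axis-by-axis elimination: `iterOp op f 0 = f` and
`iterOp op f (k+1) (…, x_k, x_{k+1}, …) = op k (t ↦ iterOp op f k (…, t, x_{k+1}, …))`, i.e. the
functional `op k` (an integral `∫₀¹ · dx_k`, or a quadrature rule `Σ_i w_k^{(i)} ·(x_k^{(i)})`) is
applied along axis `k` to the result of eliminating the axes `0, …, k-1`.  With `op k = ∫₀¹ · dx_k`
this is the recursion `I_k(x_{k+1}, …, x_d) = ∫₀¹ I_{k-1}(x_k, x_{k+1}, …, x_d) dx_k` of [VST21, §3.6];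
the result is kept as a function of all `d` coordinates, constant in the eliminated ones
(`iterOp_congr`). [cite: VysotskySmirnovTyrtyshnikov2021, §3.6] -/
def iterOp (op : ℕ → (X → E) → E) (f : (Fin d → X) → E) : ℕ → (Fin d → X) → E
  | 0 => f
  | k + 1 => fun y => op k (fun t => iterOp op f k (setCoord y k t))

/-- `I_0 = f`. [cite: VysotskySmirnovTyrtyshnikov2021, §3.6] -/
@[simp] theorem iterOp_zero (op : ℕ → (X → E) → E) (f : (Fin d → X) → E) : iterOp op f 0 = f :=
  rfl

/-- `I_{k+1}(x_{k+1}, …) = op_k (t ↦ I_k(t, x_{k+1}, …))` (in the paper's numbering,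
`I_k = ∫₀¹ I_{k-1}(x_k, …) dx_k`). [cite: VysotskySmirnovTyrtyshnikov2021, §3.6] -/
theorem iterOp_succ (op : ℕ → (X → E) → E) (f : (Fin d → X) → E) (k : ℕ) (y : Fin d → X) :
    iterOp op f (k + 1) y = op k (fun t => iterOp op f k (setCoord y k t)) :=
  rfl

/-- After eliminating the axes `0, …, k-1` the result depends only on the coordinates `x_k, …, x_{d-1}`
(the paper writes `I_k(x_{k+1}, …, x_d)`). [cite: VysotskySmirnovTyrtyshnikov2021, §3.6] -/
theorem iterOp_congr (op : ℕ → (X → E) → E) (f : (Fin d → X) → E) :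
    ∀ (k : ℕ) {y y' : Fin d → X}, (∀ j : Fin d, k ≤ (j : ℕ) → y j = y' j) →
      iterOp op f k y = iterOp op f k y'
  | 0, y, y', h => by
      have hyy' : y = y' := funext fun j => h j (Nat.zero_le _)
      subst hyy'
      rfl
  | k + 1, y, y', h => by
      simp only [iterOp_succ]
      congr 1
      funext t
      refine iterOp_congr op f k fun j hj => ?_
      by_cases hjk : (j : ℕ) = k
      · rw [setCoord_of_eq hjk, setCoord_of_eq hjk]
      · rw [setCoord_of_ne hjk, setCoord_of_ne hjk]
        exact h j (by omega)

/-- In particular the full elimination `iterOp op f k`, `k ≥ d`, is a constant (`I_d ≡ I(f)`).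
[cite: VysotskySmirnovTyrtyshnikov2021, §3.6] -/
theorem iterOp_eq_of_le (op : ℕ → (X → E) → E) (f : (Fin d → X) → E) {k : ℕ} (hk : d ≤ k)
    (y y' : Fin d → X) : iterOp op f k y = iterOp op f k y' :=
  iterOp_congr op f k fun j hj => absurd (lt_of_lt_of_le j.isLt (hk.trans hj)) (lt_irrefl _)

end Elimination

/-! ### The tensor-product rule `S_{X,W}` and its partial sums -/

section Rule

variable [AddCommMonoid E] [Module ℝ E] {ι : ℕ → Type*} {d : ℕ}

/-- The weight tensor `W(i_1, …, i_d) = w_1^{(i_1)} ⋯ w_d^{(i_d)}` of the tensor-product rule with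
weights `w_k^{(i)}`, `i : ι k`, on axis `k`. [cite: VysotskySmirnovTyrtyshnikov2021, §2] -/
def weightTensor (w : ∀ k, ι k → ℝ) (i : (k : Fin d) → ι k) : ℝ :=
  ∏ k : Fin d, w k (i k)

/-- The grid point `(x_1^{(i_1)}, …, x_d^{(i_d)})` of the grid `X = {x_1^{(i_1)}} × ⋯ × {x_d^{(i_d)}}`
with nodes `x_k^{(i)}`, `i : ι k`, on axis `k`. [cite: VysotskySmirnovTyrtyshnikov2021, §2] -/
def node (x : ∀ k, ι k → X) (i : (k : Fin d) → ι k) : Fin d → X :=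
  fun k => x k (i k)

/-- The point whose coordinates `j < k` are the nodes `x_j^{(i_j)}` and whose coordinates `j ≥ k`
are those of `y`. [folklore] -/
private def fill (x : ∀ k, ι k → X) (y : Fin d → X) (k : ℕ) (i : (j : Fin k) → ι j) :
    Fin d → X :=
  fun j => if h : (j : ℕ) < k then x j (i ⟨j, h⟩) else y j

/-- [folklore] -/
private theorem fill_apply_of_lt (x : ∀ k, ι k → X) (y : Fin d → X) (k : ℕ)
    (i : (j : Fin k) → ι j) {j : Fin d} (h : (j : ℕ) < k) : fill x y k i j = x j (i ⟨j, h⟩) :=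
  dif_pos h

/-- [folklore] -/
private theorem fill_apply_of_not_lt (x : ∀ k, ι k → X) (y : Fin d → X) (k : ℕ)
    (i : (j : Fin k) → ι j) {j : Fin d} (h : ¬ (j : ℕ) < k) : fill x y k i j = y j :=
  dif_neg h

/-- [folklore] -/
private theorem fill_self (x : ∀ k, ι k → X) (y : Fin d → X) (i : (j : Fin d) → ι j) :
    fill x y d i = node x i :=
  funext fun j => fill_apply_of_lt x y d i j.isLt

/-- Splitting a multi-index `(i_0, …, i_k)` into `(i_0, …, i_{k-1})` and `i_k`: the nodes.
[folklore] -/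
private theorem fill_snocEquiv (x : ∀ k, ι k → X) (y : Fin d → X) (k : ℕ) (a : ι k)
    (i : (j : Fin k) → ι j) :
    fill x y (k + 1) (Fin.snocEquiv (fun j : Fin (k + 1) => ι (j : ℕ)) (a, i)) =
      fill x (setCoord y k (x k a)) k i := by
  funext j
  by_cases hlt : (j : ℕ) < k
  · rw [fill_apply_of_lt _ _ _ _ (show (j : ℕ) < k + 1 by omega), fill_apply_of_lt _ _ _ _ hlt]
    exact congrArg (x j)
      (Fin.snoc_castSucc (α := fun j : Fin (k + 1) => ι (j : ℕ)) a i ⟨j, hlt⟩)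
  · by_cases heq : (j : ℕ) = k
    · rw [fill_apply_of_lt _ _ _ _ (show (j : ℕ) < k + 1 by omega),
        fill_apply_of_not_lt _ _ _ _ hlt, setCoord_of_eq heq]
      have key : ∀ z : Fin (k + 1), (z : ℕ) = k →
          x z (Fin.snocEquiv (fun j : Fin (k + 1) => ι (j : ℕ)) (a, i) z) = x k a := by
        intro z hz
        obtain rfl : z = Fin.last k := Fin.ext hz
        exact congrArg (x _) (Fin.snoc_last (α := fun j : Fin (k + 1) => ι (j : ℕ)) a i)
      exact key ⟨j, by omega⟩ heq
    · rw [fill_apply_of_not_lt _ _ _ _ (show ¬ (j : ℕ) < k + 1 by omega),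
        fill_apply_of_not_lt _ _ _ _ hlt, setCoord_of_ne heq]

/-- Splitting a multi-index `(i_0, …, i_k)` into `(i_0, …, i_{k-1})` and `i_k`: the weights.
[folklore] -/
private theorem prod_snocEquiv (w : ∀ k, ι k → ℝ) (k : ℕ) (a : ι k) (i : (j : Fin k) → ι j) :
    ∏ j : Fin (k + 1), w j (Fin.snocEquiv (fun j : Fin (k + 1) => ι (j : ℕ)) (a, i) j) =
      (∏ j : Fin k, w j (i j)) * w k a := by
  rw [Fin.prod_univ_castSucc]
  refine congrArg₂ (· * ·) ?_ ?_
  · exact Finset.prod_congr rfl fun j _ =>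
      congrArg (w _) (Fin.snoc_castSucc (α := fun j : Fin (k + 1) => ι (j : ℕ)) a i j)
  · exact congrArg (w _) (Fin.snoc_last (α := fun j : Fin (k + 1) => ι (j : ℕ)) a i)

/-- Splitting a multi-index `(i_0, …, i_k)` into `(i_0, …, i_{k-1})` and `i_k`: the summands.
[folklore] -/
private theorem summand_snocEquiv (x : ∀ k, ι k → X) (w : ∀ k, ι k → ℝ) (f : (Fin d → X) → E)
    (y : Fin d → X) (k : ℕ) (a : ι k) (i : (j : Fin k) → ι j) :
    (∏ j : Fin (k + 1), w j (Fin.snocEquiv (fun j : Fin (k + 1) => ι (j : ℕ)) (a, i) j)) •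
        f (fill x y (k + 1) (Fin.snocEquiv (fun j : Fin (k + 1) => ι (j : ℕ)) (a, i))) =
      (w k a * ∏ j : Fin k, w j (i j)) • f (fill x (setCoord y k (x k a)) k i) := by
  rw [prod_snocEquiv, fill_snocEquiv, mul_comm]

/-- `W ≥ 0` when all weights are nonnegative.
[cite: VysotskySmirnovTyrtyshnikov2021, §3.6 proof of Theorem 1] -/
theorem weightTensor_nonneg (w : ∀ k, ι k → ℝ) (hw₀ : ∀ k < d, ∀ i, 0 ≤ w k i)
    (i : (k : Fin d) → ι k) : 0 ≤ weightTensor w i := by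
  unfold weightTensor
  exact Finset.prod_nonneg fun k _ => hw₀ k k.isLt (i k)

variable [∀ k, Fintype (ι k)]

/-- The tensor-product quadrature rule
`S_{X,W}(f) = Σ_{i_1, …, i_d} f(x_1^{(i_1)}, …, x_d^{(i_d)}) W(i_1, …, i_d) = ⟨Ā_{X,f}, W⟩`, where
`A_{X,f}(i) = f (node x i)` is the tensor of values of `f` on the grid.
[cite: VysotskySmirnovTyrtyshnikov2021, §2] -/
def tensorRule (x : ∀ k, ι k → X) (w : ∀ k, ι k → ℝ) (f : (Fin d → X) → E) : E :=
  ∑ i : ((k : Fin d) → ι k), weightTensor w i • f (node x i)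

/-- The partial sums of the proof of Lemma 1: `partialRule x w f k (…, x_{k+1}, …, x_d)
= Σ_{i_1, …, i_k} f(x_1^{(i_1)}, …, x_k^{(i_k)}, x_{k+1}, …, x_d) w_1^{(i_1)} ⋯ w_k^{(i_k)}`, defined
by applying the rule of axis `k` to the `(k-1)`-st partial sum (`iterOp` with
`op k g = Σ_i w_k^{(i)} g(x_k^{(i)})`); see `partialRule_eq_tensorRule` for `k = d`.
[cite: VysotskySmirnovTyrtyshnikov2021, §3.6 proof of Lemma 1] -/
def partialRule (x : ∀ k, ι k → X) (w : ∀ k, ι k → ℝ) (f : (Fin d → X) → E) :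
    ℕ → (Fin d → X) → E :=
  iterOp (fun k g => ∑ i, w k i • g (x k i)) f

/-- The `k`-th partial sum written out:
`Σ_{i_1, …, i_k} w_1^{(i_1)} ⋯ w_k^{(i_k)} f(x_1^{(i_1)}, …, x_k^{(i_k)}, x_{k+1}, …, x_d)`. [folklore] -/
private theorem partialRule_eq_sum_fill (x : ∀ k, ι k → X) (w : ∀ k, ι k → ℝ)
    (f : (Fin d → X) → E) :
    ∀ (k : ℕ) (y : Fin d → X), partialRule x w f k y =
      ∑ i : ((j : Fin k) → ι j), (∏ j : Fin k, w j (i j)) • f (fill x y k i)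
  | 0, y => by
      rw [Fintype.sum_unique, Fin.prod_univ_zero, one_smul]
      exact congrArg f (funext fun j => (fill_apply_of_not_lt x y 0 _ (Nat.not_lt_zero _)).symm)
  | k + 1, y => by
      have ih : ∀ z : Fin d → X, partialRule x w f k z =
          ∑ i : ((j : Fin k) → ι j), (∏ j : Fin k, w j (i j)) • f (fill x z k i) :=
        fun z => partialRule_eq_sum_fill x w f k z
      show ∑ a, w k a • partialRule x w f k (setCoord y k (x k a)) = _
      simp_rw [ih, Finset.smul_sum, smul_smul]
      rw [← (Fin.snocEquiv fun j : Fin (k + 1) => ι (j : ℕ)).sum_comp, Fintype.sum_prod_type]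
      exact Finset.sum_congr rfl fun a _ => Finset.sum_congr rfl fun i _ =>
        (summand_snocEquiv x w f y k a i).symm

/-- The `d`-th partial sum is the tensor-product rule:
`Σ_{i_1, …, i_d} f(x_1^{(i_1)}, …, x_d^{(i_d)}) w_1^{(i_1)} ⋯ w_d^{(i_d)} = S_{X,W}(f)` (used for
`k = d` at the end of the proof of Lemma 1).
[cite: VysotskySmirnovTyrtyshnikov2021, §3.6 proof of Lemma 1] -/
theorem partialRule_eq_tensorRule (x : ∀ k, ι k → X) (w : ∀ k, ι k → ℝ) (f : (Fin d → X) → E)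
    (y : Fin d → X) : partialRule x w f d y = tensorRule x w f := by
  rw [partialRule_eq_sum_fill, tensorRule]
  refine Finset.sum_congr rfl fun i _ => ?_
  rw [fill_self]
  rfl

/-- `Σ_{i_1, …, i_d} W(i_1, …, i_d) = ∏_k Σ_{i_k} w_k^{(i_k)} = 1` when every axis rule is exact for
constants. [cite: VysotskySmirnovTyrtyshnikov2021, §3.6 proof of Theorem 1] -/
theorem sum_weightTensor_eq_one (w : ∀ k, ι k → ℝ) (hw₁ : ∀ k < d, ∑ i, w k i = 1) :
    ∑ i : ((k : Fin d) → ι k), weightTensor w i = 1 := by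
  simp only [weightTensor]
  rw [← Fintype.prod_sum fun (k : Fin d) (j : ι k) => w k j]
  exact Finset.prod_eq_one fun k _ => hw₁ k k.isLt

/-- (good quadrature) gives `0 ≤ w_k^{(i_k)} ≤ 1`, hence `W ≤ 1`.
[cite: VysotskySmirnovTyrtyshnikov2021, §3.6 proof of Theorem 1] -/
theorem weightTensor_le_one (w : ∀ k, ι k → ℝ) (hw₀ : ∀ k < d, ∀ i, 0 ≤ w k i)
    (hw₁ : ∀ k < d, ∑ i, w k i = 1) (i : (k : Fin d) → ι k) : weightTensor w i ≤ 1 := by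
  unfold weightTensor
  refine Finset.prod_le_one (fun k _ => hw₀ k k.isLt (i k)) fun k _ => ?_
  calc w k (i k) ≤ ∑ j, w k j :=
        Finset.single_le_sum (fun j _ => hw₀ k k.isLt j) (Finset.mem_univ (i k))
    _ = 1 := hw₁ k k.isLt

/-- `‖W‖_F² = Σ_{i_1, …, i_d} ∏_k (w_k^{(i_k)})² ≤ Σ ∏ w_k^{(i_k)} = 1`, i.e. `‖W‖_F ≤ 1`.
[cite: VysotskySmirnovTyrtyshnikov2021, §3.6 proof of Theorem 1] -/
theorem sum_weightTensor_sq_le_one (w : ∀ k, ι k → ℝ) (hw₀ : ∀ k < d, ∀ i, 0 ≤ w k i)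
    (hw₁ : ∀ k < d, ∑ i, w k i = 1) :
    ∑ i : ((k : Fin d) → ι k), weightTensor w i ^ 2 ≤ 1 :=
  calc ∑ i : ((k : Fin d) → ι k), weightTensor w i ^ 2
      ≤ ∑ i : ((k : Fin d) → ι k), weightTensor w i :=
        Finset.sum_le_sum fun i _ => by
          rw [sq]
          exact mul_le_of_le_one_left (weightTensor_nonneg w hw₀ i)
            (weightTensor_le_one w hw₀ hw₁ i)
    _ = 1 := sum_weightTensor_eq_one w hw₁

end Rule

/-! ### Lemma 1 and Theorem 1 -/

section Error

variable [NormedAddCommGroup E] [NormedSpace ℝ E] {ι : ℕ → Type*} [∀ k, Fintype (ι k)] {d : ℕ}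

/-- The induction (integration-induction) of the proof of Lemma 1: if every axis rule has
nonnegative weights summing to `1` and integrates the partial integrals along its axis to accuracy
`ε` at all admissible values of the remaining coordinates, then
`‖I_k(x_{k+1}, …) - Σ_{i_1, …, i_k} f(x_1^{(i_1)}, …, x_k^{(i_k)}, x_{k+1}, …) w_1^{(i_1)} ⋯ w_k^{(i_k)}‖
≤ k·ε` for all `k ≤ d` and all admissible `x_{k+1}, …, x_d`.  Stated with an arbitrary functional
`op k` in place of `∫₀¹ · dx_k` (so `I_k = iterOp op f k`) and an arbitrary set `S ∋ x_k^{(i)}` of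
admissible coordinates in place of `[0,1]`: the proof in [VST21] (add and subtract
`Σ_{i_k} I_{k-1}(x_k^{(i_k)}, …) w_k^{(i_k)}`, triangle inequality, positivity of the weights,
induction hypothesis, `Σ_{i_k} w_k^{(i_k)} = 1`) uses nothing else.
[cite: VysotskySmirnovTyrtyshnikov2021, §3.6 Lemma 1 (proof, inequality (integration-induction))] -/
theorem norm_iterOp_sub_partialRule_le (op : ℕ → (X → E) → E) (f : (Fin d → X) → E)
    (x : ∀ k, ι k → X) (w : ∀ k, ι k → ℝ) (S : Set X) {ε : ℝ}
    (hx : ∀ k < d, ∀ i, x k i ∈ S)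
    (hw₀ : ∀ k < d, ∀ i, 0 ≤ w k i) (hw₁ : ∀ k < d, ∑ i, w k i = 1)
    (hop : ∀ k < d, ∀ y : Fin d → X, (∀ j, y j ∈ S) →
      ‖op k (fun t => iterOp op f k (setCoord y k t)) -
          ∑ i, w k i • iterOp op f k (setCoord y k (x k i))‖ ≤ ε) :
    ∀ k ≤ d, ∀ y : Fin d → X, (∀ j, y j ∈ S) →
      ‖iterOp op f k y - partialRule x w f k y‖ ≤ k * ε := by
  intro k
  induction k with
  | zero =>
      intro _ y _
      simp [partialRule]
  | succ k ih =>
      intro hk y hy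
      have hk' : k < d := hk
      change ‖op k (fun t => iterOp op f k (setCoord y k t)) -
          ∑ i, w k i • partialRule x w f k (setCoord y k (x k i))‖ ≤ ((k + 1 : ℕ) : ℝ) * ε
      calc ‖op k (fun t => iterOp op f k (setCoord y k t)) -
              ∑ i, w k i • partialRule x w f k (setCoord y k (x k i))‖
          ≤ ‖op k (fun t => iterOp op f k (setCoord y k t)) -
                ∑ i, w k i • iterOp op f k (setCoord y k (x k i))‖ +
              ‖∑ i, w k i • iterOp op f k (setCoord y k (x k i)) -
                ∑ i, w k i • partialRule x w f k (setCoord y k (x k i))‖ :=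
            norm_sub_le_norm_sub_add_norm_sub _ _ _
        _ ≤ ε + ∑ i, w k i * (k * ε) := by
            refine add_le_add (hop k hk' y hy) ?_
            rw [← Finset.sum_sub_distrib]
            refine (norm_sum_le _ _).trans (Finset.sum_le_sum fun i _ => ?_)
            rw [← smul_sub, norm_smul, Real.norm_of_nonneg (hw₀ k hk' i)]
            exact mul_le_mul_of_nonneg_left
              (ih hk'.le _ (setCoord_mem hy k (hx k hk' i))) (hw₀ k hk' i)
        _ = ((k + 1 : ℕ) : ℝ) * ε := by
            rw [← Finset.sum_mul, hw₁ k hk']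
            push_cast
            ring

/-- The partial integrals `I_k(x_{k+1}, …, x_d) = ∫₀¹⋯∫₀¹ f(x_1, …, x_d) dx_1 ⋯ dx_k` (`I_0 = f`),
as functions on the whole cube constant in the integrated coordinates; in the `0`-based numbering of
this file `partialIntegral f k` has the axes `0, …, k-1` integrated out and
`partialIntegral f (k+1) (…) = ∫₀¹ partialIntegral f k (…, x_k := t, …) dt` (`partialIntegral_succ`).
[cite: VysotskySmirnovTyrtyshnikov2021, §3.6] -/
def partialIntegral (f : (Fin d → ℝ) → E) : ℕ → (Fin d → ℝ) → E :=
  iterOp (fun _ g => ∫ t in (0:ℝ)..1, g t) f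

/-- `I(f) = I_d = ∫₀¹⋯∫₀¹ f(x_1, …, x_d) dx_1 ⋯ dx_d`, the iterated integral over the unit cube
(evaluated at the corner `0`; it does not depend on the point, `partialIntegral_eq_iteratedIntegral`).
[cite: VysotskySmirnovTyrtyshnikov2021, §3.6 (`I_d ≡ I(f)`)] -/
def iteratedIntegral (f : (Fin d → ℝ) → E) : E :=
  partialIntegral f d fun _ => 0

/-- `I_0 ≡ f`. [cite: VysotskySmirnovTyrtyshnikov2021, §3.6] -/
@[simp] theorem partialIntegral_zero (f : (Fin d → ℝ) → E) : partialIntegral f 0 = f :=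
  rfl

/-- `I_k(x_{k+1}, …, x_d) = ∫₀¹ I_{k-1}(x_k, x_{k+1}, …, x_d) dx_k`.
[cite: VysotskySmirnovTyrtyshnikov2021, §3.6] -/
theorem partialIntegral_succ (f : (Fin d → ℝ) → E) (k : ℕ) (y : Fin d → ℝ) :
    partialIntegral f (k + 1) y = ∫ t in (0:ℝ)..1, partialIntegral f k (setCoord y k t) :=
  rfl

/-- `I_d ≡ I(f)` is a constant. [cite: VysotskySmirnovTyrtyshnikov2021, §3.6] -/
theorem partialIntegral_eq_iteratedIntegral (f : (Fin d → ℝ) → E) (y : Fin d → ℝ) :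
    partialIntegral f d y = iteratedIntegral f :=
  iterOp_eq_of_le _ f le_rfl y _

/-- **Lemma 1** of [VST21].  Let the quadrature rule of every axis `k` (nodes `x_k^{(i)} ∈ [0,1]`,
weights `w_k^{(i)}`) have nonnegative weights and be exact for constants,
`w_k^{(i)} ≥ 0`, `Σ_i w_k^{(i)} = 1 = ∫₀¹ 1 dx` (good quadrature), and assume that for all
`x_{k+1}, …, x_d ∈ [0,1]`
`‖∫₀¹ I_{k-1}(x_k, x_{k+1}, …, x_d) dx_k - Σ_i I_{k-1}(x_k^{(i)}, x_{k+1}, …, x_d) w_k^{(i)}‖ ≤ ε_int`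
(partial integral).  Then `‖I(f) - S_{X,W}(f)‖ ≤ d·ε_int`.  (In the hypothesis the point `y` ranges
over the cube and only its coordinates beyond axis `k` matter.)
[cite: VysotskySmirnovTyrtyshnikov2021, §3.6 Lemma 1] -/
theorem norm_iteratedIntegral_sub_tensorRule_le (f : (Fin d → ℝ) → E)
    (x : ∀ k, ι k → ℝ) (w : ∀ k, ι k → ℝ) {ε : ℝ}
    (hx : ∀ k < d, ∀ i, x k i ∈ Set.Icc (0:ℝ) 1)
    (hw₀ : ∀ k < d, ∀ i, 0 ≤ w k i) (hw₁ : ∀ k < d, ∑ i, w k i = 1)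
    (hf : ∀ k < d, ∀ y : Fin d → ℝ, (∀ j, y j ∈ Set.Icc (0:ℝ) 1) →
      ‖(∫ t in (0:ℝ)..1, partialIntegral f k (setCoord y k t)) -
          ∑ i, w k i • partialIntegral f k (setCoord y k (x k i))‖ ≤ ε) :
    ‖iteratedIntegral f - tensorRule x w f‖ ≤ d * ε := by
  have h := norm_iterOp_sub_partialRule_le (fun _ g => ∫ t in (0:ℝ)..1, g t) f x w
    (Set.Icc (0:ℝ) 1) hx hw₀ hw₁ hf d le_rfl (fun _ => 0) fun _ => ⟨le_rfl, zero_le_one⟩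
  rw [partialRule_eq_tensorRule] at h
  exact h

/-- The Cauchy–Bunyakovsky–Schwarz step of the proof of Theorem 1:
`‖⟨Ā_{X,f}, W⟩ - ⟨Ā', W⟩‖ = ‖⟨A_{X,f} - A', W⟩‖ ≤ ‖A_{X,f} - A'‖_F ‖W‖_F ≤ ‖A_{X,f} - A'‖_F`, for any
two tensors `A, A'` on the grid and weights as in Lemma 1 (`‖W‖_F ≤ 1`,
`sum_weightTensor_sq_le_one`); the Frobenius norm is written out as `√(Σ_i ‖A(i) - A'(i)‖²)`.
[cite: VysotskySmirnovTyrtyshnikov2021, §3.6 Theorem 1 (proof)] -/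
theorem norm_sum_weightTensor_smul_sub_le (w : ∀ k, ι k → ℝ) (hw₀ : ∀ k < d, ∀ i, 0 ≤ w k i)
    (hw₁ : ∀ k < d, ∑ i, w k i = 1) (A A' : ((k : Fin d) → ι k) → E) :
    ‖∑ i, weightTensor w i • A i - ∑ i, weightTensor w i • A' i‖ ≤ √(∑ i, ‖A i - A' i‖ ^ 2) := by
  rw [← Finset.sum_sub_distrib]
  calc ‖∑ i, (weightTensor w i • A i - weightTensor w i • A' i)‖
      ≤ ∑ i, weightTensor w i * ‖A i - A' i‖ := by
        refine (norm_sum_le _ _).trans (le_of_eq (Finset.sum_congr rfl fun i _ => ?_))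
        rw [← smul_sub, norm_smul, Real.norm_of_nonneg (weightTensor_nonneg w hw₀ i)]
    _ ≤ √(∑ i, weightTensor w i ^ 2) * √(∑ i, ‖A i - A' i‖ ^ 2) :=
        Real.sum_mul_le_sqrt_mul_sqrt _ _ _
    _ ≤ 1 * √(∑ i, ‖A i - A' i‖ ^ 2) := by
        gcongr
        exact Real.sqrt_le_one.mpr (sum_weightTensor_sq_le_one w hw₀ hw₁)
    _ = √(∑ i, ‖A i - A' i‖ ^ 2) := one_mul _

/-- **Theorem 1** of [VST21].  Under the hypotheses of Lemma 1, if a tensor `A'` on the grid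
satisfies `‖A_{X,f} - A'‖_F ≤ ε_appr` (Frobenius norm, `A_{X,f}(i) = f(x^{(i)})` the tensor of
function values), then `‖I(f) - ⟨Ā', W⟩‖ ≤ d·ε_int + ε_appr`, where `⟨Ā', W⟩ = Σ_i W(i) A'(i)` is
the rule evaluated through `A'`.
[cite: VysotskySmirnovTyrtyshnikov2021, §3.6 Theorem 1] -/
theorem norm_iteratedIntegral_sub_sum_weightTensor_smul_le (f : (Fin d → ℝ) → E)
    (x : ∀ k, ι k → ℝ) (w : ∀ k, ι k → ℝ) {ε εappr : ℝ}
    (hx : ∀ k < d, ∀ i, x k i ∈ Set.Icc (0:ℝ) 1)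
    (hw₀ : ∀ k < d, ∀ i, 0 ≤ w k i) (hw₁ : ∀ k < d, ∑ i, w k i = 1)
    (hf : ∀ k < d, ∀ y : Fin d → ℝ, (∀ j, y j ∈ Set.Icc (0:ℝ) 1) →
      ‖(∫ t in (0:ℝ)..1, partialIntegral f k (setCoord y k t)) -
          ∑ i, w k i • partialIntegral f k (setCoord y k (x k i))‖ ≤ ε)
    (A' : ((k : Fin d) → ι k) → E)
    (hA : √(∑ i, ‖f (node x i) - A' i‖ ^ 2) ≤ εappr) :
    ‖iteratedIntegral f - ∑ i, weightTensor w i • A' i‖ ≤ d * ε + εappr :=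
  calc ‖iteratedIntegral f - ∑ i, weightTensor w i • A' i‖
      ≤ ‖iteratedIntegral f - tensorRule x w f‖ +
          ‖tensorRule x w f - ∑ i, weightTensor w i • A' i‖ :=
        norm_sub_le_norm_sub_add_norm_sub _ _ _
    _ ≤ d * ε + εappr :=
        add_le_add (norm_iteratedIntegral_sub_tensorRule_le f x w hx hw₀ hw₁ hf)
          ((norm_sum_weightTensor_smul_sub_le w hw₀ hw₁ (fun i => f (node x i)) A').trans hA)

end Error

end TensorRule

end Literature.Analysis.Quadrature
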